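import Summits.CriticalPhenomena.PercolationContinuityZ3.Theorems.PercNearOneGluingNoHeavyLowerTailSahiCombTriWPartialFlip
import Summits.CriticalPhenomena.PercolationContinuityZ3.Theorems.PercNearOneGluingNoHeavyLowerTailSahiCombTriWProdCube

/-!
# The dipole slack of an up-set plus that of its DUAL up-set is non-negative — `TRI_W(P) + TRI_W(P†) ≥ 0` for every `P` and every index cube

Support file of the one-cut programme (crux `NoHeavyLowerTail`, stmt-CriticalPhenomena-4575; cell `prim-masterthm`, seat P5 gen 21; memo
`FROM-prim-masterthm-p5-g21-SELF-DUAL-AND-FACES.md` §2(b)).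

For up-sets `X, Y, h` of a cube and a translate `t`, the DIPOLE SLACK is
`slack(X) = 2·#(X∩Y∩h) + #(refl X ∩ transl t Y ∩ h) − #(refl X ∩ Y ∩ h) − #(X ∩ refl Y ∩ h) − #(refl (X∩Y) ∩ h)`; `FiveUpSet.DipoleIneq` (OPEN) says
`slack(X) ≥ 0`, and implies `TriWIneq`.  The DUAL `X† := (refl X)ᶜ` of an up-set is an up-set (it contains `X` iff `X` is intersecting), and the "fuzzy
self-dual" weight `1_X + 1_{X†} = 1 + 1_X − 1_{refl X}` runs through the self-dual argument of `…SahiCombTriWPartialFlip` verbatim: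

* **`FiveUpSet.dipoleSlack_add_dual_nonneg`** — for EVERY up-set `X`: `slack(X) + slack(X†) ≥ 0` (in fact `≥ 2·(#(X∩Y∩h) − #(refl X∩Y∩h))`), all up-sets `Y, h`, all `t`
  (no intersecting hypothesis is needed: `1_X + 1_{X†} = 1 + 1_X − 1_{refl X}` pointwise for every `X`).
  Ingredients: partial-flip Kleitman (`card_inter_transl_le`) for `h ∩ X` and `h ∩ X†`, the translate lemma, Kleitman's lemma inside `Y ∩ h`.
* `FiveUpSet.triWGen_eq_dipoleSlack` — the product-cube plumbing of `…SahiCombTriWProdCube` as an IDENTITY: `triWGen U F G` is the dipole slack of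
  `(prodSet F, prodSet G, prodSet U, 1_β)`.
* **`FiveUpSet.triW_add_triW_dual_nonneg`** — for EVERY up-set `P` with dual up-set `P† = {u | uᶜ ∉ P}`:
  `0 ≤ triW P F G + triW P† F G` for every index cube, every cube and all monotone families of up-sets `F, G`.  So a counterexample to `TriWIneq`
  forces STRICTLY POSITIVE slack at its dual; for self-dual `P = P†` this is the known stratum again.
HONEST LABEL: unconditional (std axioms); `TriWIneq` itself remains OPEN — this is the σ-affine half `½(1 + 1_P − 1_{refl P})` of `1_P`; the σ-invariant half
`½(1_{P ∩ refl P} − 1_{neither})` is the open part (memo §2(b)–(c)). [this work]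
-/

namespace Summit.CriticalPhenomena.PercolationContinuityZ3.Theorems

namespace FiveUpSet

open Finset
open scoped symmDiff

variable {α : Type} [DecidableEq α] [Fintype α]

/-- The dual `(refl X)ᶜ` of any family is an up-set when `X` is (the antipodal image of an up-set is a down-set). [this work] -/
theorem isUpperSet_compl_refl {X : Finset (Finset α)} (hX : IsUpperSet (X : Set (Finset α))) :
    IsUpperSet (((refl X)ᶜ : Finset (Finset α)) : Set (Finset α)) := by
  intro a b hab ha
  rw [mem_coe, mem_compl, mem_refl] at ha ⊢
  intro hb
  exact ha (hX (compl_subset_compl.2 hab) hb)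

/-- **Slack of an up-set plus slack of its dual.**  For up-sets `X` (dual `X† = (refl X)ᶜ`), `Y, h` and any `t`:
`[#(refl X∩Y∩h) + #(X∩refl Y∩h) + #(refl (X∩Y)∩h)] + [#(refl X†∩Y∩h) + #(X†∩refl Y∩h) + #(refl (X†∩Y)∩h)]`
`≤ [2·#(X∩Y∩h) + #(refl X∩transl t Y∩h)] + [2·#(X†∩Y∩h) + #(refl X†∩transl t Y∩h)]`. [this work] -/
theorem dipoleSlack_add_dual_nonneg (X Y h : Finset (Finset α)) (t : Finset α)
    (hXu : IsUpperSet (X : Set (Finset α)))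
    (hY : IsUpperSet (Y : Set (Finset α))) (hh : IsUpperSet (h : Set (Finset α))) :
    ((refl X ∩ Y ∩ h).card + (X ∩ refl Y ∩ h).card + (refl (X ∩ Y) ∩ h).card)
      + ((refl (refl X)ᶜ ∩ Y ∩ h).card + ((refl X)ᶜ ∩ refl Y ∩ h).card + (refl ((refl X)ᶜ ∩ Y) ∩ h).card)
      ≤ (2 * (X ∩ Y ∩ h).card + (refl X ∩ transl t Y ∩ h).card)
      + (2 * ((refl X)ᶜ ∩ Y ∩ h).card + (refl (refl X)ᶜ ∩ transl t Y ∩ h).card) := by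
  -- the dual and its antipodal image
  have hXd : IsUpperSet ((((refl X)ᶜ : Finset (Finset α))) : Set (Finset α)) := isUpperSet_compl_refl hXu
  have hrd : refl (refl X)ᶜ = Xᶜ := by
    ext s; simp only [mem_refl, mem_compl, compl_compl]
  -- bookkeeping (R1)–(R6)
  have R1 : ((refl X)ᶜ ∩ Y ∩ h).card + (refl X ∩ Y ∩ h).card = (Y ∩ h).card := by
    have e : (refl X)ᶜ ∩ Y ∩ h = (Y ∩ h) \ refl X := by ext s; simp only [mem_inter, mem_compl, mem_sdiff]; tauto
    have e' : refl X ∩ Y ∩ h = (Y ∩ h) ∩ refl X := by ext s; simp only [mem_inter]; tauto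
    rw [e, e', card_sdiff_add_card_inter]
  have R2 : ((refl X)ᶜ ∩ transl t Y ∩ h).card + (refl X ∩ transl t Y ∩ h).card = (transl t Y ∩ h).card := by
    have e : (refl X)ᶜ ∩ transl t Y ∩ h = (transl t Y ∩ h) \ refl X := by ext s; simp only [mem_inter, mem_compl, mem_sdiff]; tauto
    have e' : refl X ∩ transl t Y ∩ h = (transl t Y ∩ h) ∩ refl X := by ext s; simp only [mem_inter]; tauto
    rw [e, e', card_sdiff_add_card_inter]
  have R3 : ((refl X)ᶜ ∩ refl Y ∩ h).card + (refl (X ∩ Y) ∩ h).card = (refl Y ∩ h).card := by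
    have e : (refl X)ᶜ ∩ refl Y ∩ h = (refl Y ∩ h) \ refl X := by ext s; simp only [mem_inter, mem_compl, mem_sdiff]; tauto
    have e' : refl (X ∩ Y) ∩ h = (refl Y ∩ h) ∩ refl X := by rw [refl_inter]; ext s; simp only [mem_inter]; tauto
    rw [e, e', card_sdiff_add_card_inter]
  have R4 : (refl (refl X)ᶜ ∩ Y ∩ h).card + (X ∩ Y ∩ h).card = (Y ∩ h).card := by
    have e : refl (refl X)ᶜ ∩ Y ∩ h = (Y ∩ h) \ X := by rw [hrd]; ext s; simp only [mem_inter, mem_compl, mem_sdiff]; tauto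
    have e' : X ∩ Y ∩ h = (Y ∩ h) ∩ X := by ext s; simp only [mem_inter]; tauto
    rw [e, e', card_sdiff_add_card_inter]
  have R5 : (refl ((refl X)ᶜ ∩ Y) ∩ h).card + (X ∩ refl Y ∩ h).card = (refl Y ∩ h).card := by
    have e : refl ((refl X)ᶜ ∩ Y) ∩ h = (refl Y ∩ h) \ X := by
      rw [refl_inter, hrd]; ext s; simp only [mem_inter, mem_compl, mem_sdiff]; tauto
    have e' : X ∩ refl Y ∩ h = (refl Y ∩ h) ∩ X := by ext s; simp only [mem_inter]; tauto
    rw [e, e', card_sdiff_add_card_inter]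
  have R6 : (refl (refl X)ᶜ ∩ transl t Y ∩ h).card + (h ∩ X ∩ transl t Y).card = (transl t Y ∩ h).card := by
    have e : refl (refl X)ᶜ ∩ transl t Y ∩ h = (transl t Y ∩ h) \ X := by
      rw [hrd]; ext s; simp only [mem_inter, mem_compl, mem_sdiff]; tauto
    have e' : h ∩ X ∩ transl t Y = (transl t Y ∩ h) ∩ X := by ext s; simp only [mem_inter]; tauto
    rw [e, e', card_sdiff_add_card_inter]
  -- the four estimates
  have hXh : IsUpperSet ((h ∩ X : Finset (Finset α)) : Set (Finset α)) := by rw [coe_inter]; exact hh.inter hXu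
  have hXdh : IsUpperSet ((h ∩ (refl X)ᶜ : Finset (Finset α)) : Set (Finset α)) := by rw [coe_inter]; exact hh.inter hXd
  have hYh : IsUpperSet ((Y ∩ h : Finset (Finset α)) : Set (Finset α)) := by rw [coe_inter]; exact hY.inter hh
  have i1 : (h ∩ X ∩ transl t Y).card ≤ (h ∩ X ∩ Y).card := card_inter_transl_le hXh hY t
  have i1a : h ∩ X ∩ Y = X ∩ Y ∩ h := by ext s; simp only [mem_inter]; tauto
  rw [i1a] at i1
  have i1' : (h ∩ (refl X)ᶜ ∩ transl t Y).card ≤ (h ∩ (refl X)ᶜ ∩ Y).card := card_inter_transl_le hXdh hY t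
  have i1b : h ∩ (refl X)ᶜ ∩ transl t Y = (refl X)ᶜ ∩ transl t Y ∩ h := by ext s; simp only [mem_inter]; tauto
  have i1c : h ∩ (refl X)ᶜ ∩ Y = (refl X)ᶜ ∩ Y ∩ h := by ext s; simp only [mem_inter]; tauto
  rw [i1b, i1c] at i1'
  have i2 : (h ∩ refl Y).card ≤ (h ∩ transl t Y).card := card_inter_refl_le_card_inter_transl hh hY t
  rw [inter_comm h (refl Y), inter_comm h (transl t Y)] at i2
  have i3 : (Y ∩ h ∩ refl X).card ≤ (Y ∩ h ∩ X).card := card_inter_refl_le hYh hXu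
  have i3a : Y ∩ h ∩ refl X = refl X ∩ Y ∩ h := by ext s; simp only [mem_inter]; tauto
  have i3b : Y ∩ h ∩ X = X ∩ Y ∩ h := by ext s; simp only [mem_inter]; tauto
  rw [i3a, i3b] at i3
  omega

/-! ### The `triW` consequence: `TRI(P) + TRI(P†) ≥ 0` -/

variable {β γ : Type} [DecidableEq β] [Fintype β] [DecidableEq γ] [Fintype γ]

/-- The product-cube plumbing of `triWGenIneq_of_dipoleIneq` as an IDENTITY: `triWGen U F G` equals the dipole slack of the configuration
`(X, Y, h, t) = (prodSet F, prodSet G, prodSet U, 1_β)`. [this work] -/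
theorem triWGen_eq_dipoleSlack (U F G : Finset β → Finset (Finset γ)) :
    triWGen U F G
      = 2 * ((prodSet F ∩ prodSet G ∩ prodSet U).card : ℤ) + (refl (prodSet F) ∩ transl (betaFlip β γ) (prodSet G) ∩ prodSet U).card
        - (refl (prodSet F) ∩ prodSet G ∩ prodSet U).card - (prodSet F ∩ refl (prodSet G) ∩ prodSet U).card
        - (refl (prodSet F ∩ prodSet G) ∩ prodSet U).card := by
  classical
  have memT : ∀ u : Finset (β ⊕ γ), u ∈ transl (betaFlip β γ) (prodSet G) ↔ u.toRight ∈ G u.toLeftᶜ := by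
    intro u
    rw [mem_transl, mem_prodSet, toRight_symmDiff', toLeft_symmDiff', betaFlip, Finset.toLeft_disjSum, Finset.toRight_disjSum,
      symmDiff_univ_eq_compl, symmDiff_empty_right]
  have memR : ∀ (V : Finset β → Finset (Finset γ)) (u : Finset (β ⊕ γ)), u ∈ refl (prodSet V) ↔ u.toRightᶜ ∈ V u.toLeftᶜ := by
    intro V u; rw [mem_refl, mem_prodSet, LatticeFiveUpSet.toRight_compl, LatticeFiveUpSet.toLeft_compl]
  have c1 : ((prodSet F ∩ prodSet G ∩ prodSet U).card : ℤ) = ∑ x : Finset β, ((U x ∩ F x ∩ G x).card : ℤ) := by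
    have e1 : prodSet F ∩ prodSet G ∩ prodSet U
        = univ.filter (fun u : Finset (β ⊕ γ) => u.toRight ∈ U u.toLeft ∧ u.toRight ∈ F u.toLeft ∧ u.toRight ∈ G u.toLeft) := by
      ext u; simp only [mem_inter, mem_prodSet, mem_filter, mem_univ, true_and]; tauto
    rw [e1, card_filter_prod_eq_sum (fun x w => w ∈ U x ∧ w ∈ F x ∧ w ∈ G x)]
    refine sum_congr rfl fun x _ => ?_
    congr 2; ext w; simp
  have c2 : ((prodSet F ∩ refl (prodSet G) ∩ prodSet U).card : ℤ) = ∑ x : Finset β, ((U x ∩ F x ∩ refl (G xᶜ)).card : ℤ) := by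
    have e1 : prodSet F ∩ refl (prodSet G) ∩ prodSet U
        = univ.filter (fun u : Finset (β ⊕ γ) => u.toRight ∈ U u.toLeft ∧ u.toRight ∈ F u.toLeft ∧ u.toRightᶜ ∈ G u.toLeftᶜ) := by
      ext u; simp only [mem_inter, mem_prodSet, memR, mem_filter, mem_univ, true_and]; tauto
    rw [e1, card_filter_prod_eq_sum (fun x w => w ∈ U x ∧ w ∈ F x ∧ wᶜ ∈ G xᶜ)]
    refine sum_congr rfl fun x _ => ?_
    congr 2; ext w; simp [mem_refl]
  have c4 : ((refl (prodSet F) ∩ prodSet G ∩ prodSet U).card : ℤ) = ∑ x : Finset β, ((U x ∩ refl (F xᶜ) ∩ G x).card : ℤ) := by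
    have e1 : refl (prodSet F) ∩ prodSet G ∩ prodSet U
        = univ.filter (fun u : Finset (β ⊕ γ) => u.toRight ∈ U u.toLeft ∧ u.toRightᶜ ∈ F u.toLeftᶜ ∧ u.toRight ∈ G u.toLeft) := by
      ext u; simp only [mem_inter, mem_prodSet, memR, mem_filter, mem_univ, true_and]; tauto
    rw [e1, card_filter_prod_eq_sum (fun x w => w ∈ U x ∧ wᶜ ∈ F xᶜ ∧ w ∈ G x)]
    refine sum_congr rfl fun x _ => ?_
    congr 2; ext w; simp [mem_refl]
  have c5 : ((refl (prodSet F) ∩ transl (betaFlip β γ) (prodSet G) ∩ prodSet U).card : ℤ)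
      = ∑ x : Finset β, ((U x ∩ refl (F xᶜ) ∩ G xᶜ).card : ℤ) := by
    have e1 : refl (prodSet F) ∩ transl (betaFlip β γ) (prodSet G) ∩ prodSet U
        = univ.filter (fun u : Finset (β ⊕ γ) => u.toRight ∈ U u.toLeft ∧ u.toRightᶜ ∈ F u.toLeftᶜ ∧ u.toRight ∈ G u.toLeftᶜ) := by
      ext u; simp only [mem_inter, memR, memT, mem_prodSet, mem_filter, mem_univ, true_and]; tauto
    rw [e1, card_filter_prod_eq_sum (fun x w => w ∈ U x ∧ wᶜ ∈ F xᶜ ∧ w ∈ G xᶜ)]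
    refine sum_congr rfl fun x _ => ?_
    congr 2; ext w; simp [mem_refl]
  have c3 : ((refl (prodSet F ∩ prodSet G) ∩ prodSet U).card : ℤ) = ∑ x : Finset β, ((refl (U xᶜ) ∩ F x ∩ G x).card : ℤ) := by
    have e1 : refl (prodSet F ∩ prodSet G) ∩ prodSet U
        = univ.filter (fun u : Finset (β ⊕ γ) => u.toRight ∈ U u.toLeft ∧ u.toRightᶜ ∈ F u.toLeftᶜ ∧ u.toRightᶜ ∈ G u.toLeftᶜ) := by
      ext u; simp only [mem_inter, refl_inter, memR, mem_prodSet, mem_filter, mem_univ, true_and]; tauto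
    rw [e1, card_filter_prod_eq_sum (fun x w => w ∈ U x ∧ wᶜ ∈ F xᶜ ∧ wᶜ ∈ G xᶜ)]
    have e2 : ∀ x : Finset β, ((univ.filter (fun w : Finset γ => w ∈ U x ∧ wᶜ ∈ F xᶜ ∧ wᶜ ∈ G xᶜ)).card : ℤ)
        = ((refl (U xᶜᶜ) ∩ F xᶜ ∩ G xᶜ).card : ℤ) := by
      intro x
      rw [← card_refl (refl (U xᶜᶜ) ∩ F xᶜ ∩ G xᶜ)]
      congr 2; ext w
      simp [mem_refl, compl_compl]
    simp only [e2]
    exact Fintype.sum_equiv (complEquiv β) _ _ (fun x => by simp [complEquiv])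
  rw [c1, c2, c3, c4, c5]
  unfold triWGen triWGenTerm
  simp only [sum_add_distrib, sum_sub_distrib, ← mul_sum]
  ring

/-- The cylinder over the dual up-set `{u | uᶜ ∉ P}` is the dual `(refl ·)ᶜ` of the cylinder. [this work] -/
theorem prodSet_const_dual (P : Finset (Finset γ)) :
    prodSet (fun _ : Finset β => (univ.filter (fun u : Finset γ => uᶜ ∉ P)))
      = (refl (prodSet (fun _ : Finset β => P)))ᶜ := by
  classical
  ext u
  rw [mem_prodSet, mem_filter, mem_compl, mem_refl, mem_prodSet, LatticeFiveUpSet.toRight_compl]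
  simp

/-- **`TRI(P) + TRI(P†) ≥ 0`.**  For EVERY up-set `P` and its dual up-set `P† = {u | uᶜ ∉ P}` (written `univ.filter (fun u => uᶜ ∉ P)`):
`0 ≤ triW P F G + triW P† F G` for every index cube `Finset β`, every cube `Finset γ` and all monotone families of up-sets `F, G`
(for self-dual `P = P†` this is the self-dual stratum; for intersecting `P` it says that a counterexample forces strictly positive slack at `P† ⊋ P`). [this work] -/
theorem triW_add_triW_dual_nonneg (P : Finset (Finset γ)) (F G : Finset β → Finset (Finset γ))
    (hP : IsUpperSet (P : Set (Finset γ)))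
    (hF : ∀ x, IsUpperSet (F x : Set (Finset γ))) (hG : ∀ x, IsUpperSet (G x : Set (Finset γ)))
    (hFm : Monotone F) (hGm : Monotone G) :
    0 ≤ triW P F G + triW (univ.filter (fun u : Finset γ => uᶜ ∉ P)) F G := by
  classical
  rw [← triWGen_const_eq_triW P F G, ← triWGen_const_eq_triW (univ.filter (fun u : Finset γ => uᶜ ∉ P)) F G,
    triWGen_eq_dipoleSlack, triWGen_eq_dipoleSlack, prodSet_const_dual]
  have hX : IsUpperSet ((prodSet (fun _ : Finset β => P) : Finset (Finset (β ⊕ γ))) : Set (Finset (β ⊕ γ))) :=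
    isUpperSet_prodSet (fun _ => hP) (fun _ _ _ => le_rfl)
  have key := dipoleSlack_add_dual_nonneg (prodSet (fun _ : Finset β => P)) (prodSet G) (prodSet F) (betaFlip β γ)
    hX (isUpperSet_prodSet hG hGm) (isUpperSet_prodSet hF hFm)
  have keyZ : (((refl (prodSet fun _ : Finset β => P) ∩ prodSet G ∩ prodSet F).card : ℤ)
        + ((prodSet fun _ : Finset β => P) ∩ refl (prodSet G) ∩ prodSet F).card
        + (refl ((prodSet fun _ : Finset β => P) ∩ prodSet G) ∩ prodSet F).card)
      + (((refl (refl (prodSet fun _ : Finset β => P))ᶜ ∩ prodSet G ∩ prodSet F).card : ℤ)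
        + ((refl (prodSet fun _ : Finset β => P))ᶜ ∩ refl (prodSet G) ∩ prodSet F).card
        + (refl ((refl (prodSet fun _ : Finset β => P))ᶜ ∩ prodSet G) ∩ prodSet F).card)
      ≤ (2 * (((prodSet fun _ : Finset β => P) ∩ prodSet G ∩ prodSet F).card : ℤ)
          + (refl (prodSet fun _ : Finset β => P) ∩ transl (betaFlip β γ) (prodSet G) ∩ prodSet F).card)
        + (2 * (((refl (prodSet fun _ : Finset β => P))ᶜ ∩ prodSet G ∩ prodSet F).card : ℤ)
          + (refl (refl (prodSet fun _ : Finset β => P))ᶜ ∩ transl (betaFlip β γ) (prodSet G) ∩ prodSet F).card) := by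
    exact_mod_cast key
  linarith

end FiveUpSet

end Summit.CriticalPhenomena.PercolationContinuityZ3.Theorems
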